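import Mathlib
import HarnessLib
import Literature.Analysis.FluidPDE.VectorCalculus
import Literature.Analysis.FluidPDE.VorticityCalculus
import Summits.NavierStokesRegularity.NavierStokesRegularity.Theorems.UnthreadedDoorAntidynamoRadialDivFreeBranch
import Summits.NavierStokesRegularity.NavierStokesRegularity.Theorems.UnthreadedDoorAntidynamoSpherePathCoefficient
import Summits.NavierStokesRegularity.NavierStokesRegularity.Theorems.UnthreadedDoorAntidynamoChunkVorticity
import Summits.NavierStokesRegularity.NavierStokesRegularity.Theorems.UnthreadedDoorAntidynamoAnalyticContinuation
import Summits.NavierStokesRegularity.NavierStokesRegularity.Theorems.UnthreadedDoorAntidynamoSphereChord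

/-!
# Route `UnthreadedDoor` / `ThreadingFlux`, crux `PoloidalLiouville` (stmt-NavierStokesRegularity-1222), antidynamo v2 skeleton
# (sha16 `4ebf5683127b`), rung `stub_singleDegreeRung` (BC5): STEP S2 ASSEMBLED — THE VORTICITY OF A SINGLE-DEGREE SLICE IS
# `ĝ(‖y‖) • (∇Q × y)` WITH AN ANALYTIC RADIAL COEFFICIENT (junk-robust, analytic class)

Support file (seat leafhand-ns-unthreadeddoor-1 g0, cell decomp-ns), `--supports stmt-NavierStokesRegularity-1222 --as helper`; theorems only.
Assembles the hand's bricks (radial branch p795031, spherical-path coefficient regularity p795123, chunk vorticity p795205, analytic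
continuation p795308, sphere chords p795508) into step S2 of the census plan for an INDEPENDENT proof of the rung:

★★ `exists_analytic_coeff_curl_eq` — let `v : ℝ³ → ℝ³` be `C^ω` and divergence free, and suppose `v x = gradient φ x + (g ‖x‖ · Q x) • x`
for ALL `x`, with `φ : ℝ³ → ℝ`, `g : ℝ → ℝ` ARBITRARY (Mathlib's junk `gradient`) and an analytic angular profile `Q` that is
positively homogeneous, nowhere locally constant on the unit sphere, and whose toroidal field `Λ = ∇Q × id` is non-zero on a dense set
and along rays through its non-zeros (all satisfied by a non-zero solid harmonic of degree `l ≥ 1`).  Then there is `ĝ`, real-analytic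
on `(0,∞)`, with
  `curl v z = ĝ(‖z‖) • (∇Q(z) × z)`   for every `z ≠ 0`.
Case split on the differentiability set `D` of `φ`: if `interior D = ∅` the slice is radial (closed condition on `closure Dᶜ = ℝ³`) and
divergence free, hence `≡ 0`; otherwise pick `x₁ ∈ interior D` with `Λ x₁ ≠ 0`, a nearby direction `θ₂` separating `Q`, the normalised
chord `γ`, a thin shell of radii `J` around `‖x₁‖` with `r γ([0,1]) ⊂ interior D`; the path brick makes `g` smooth on `J`, the chunk
brick gives the vorticity form on the chunk, and analyticity propagates it to `ℝ³ ∖ {0}`.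

HONEST LABEL: step S2 of a plan (S1 analyticity — tree; S3 joint regularity; S4 `Δ(ĝΛ) = (Dĝ)Λ`; S5 the dynamics, research) for a
plan-only stub; nothing here proves the rung, the wall, `PoloidalLiouville` (1222) or bears on NS regularity.  [folklore]
-/

noncomputable section

-- the summit and its single sub-problem share the name (CONVENTIONS §1)
set_option linter.dupNamespace false

open scoped Topology InnerProductSpace RealInnerProductSpace ContDiff
open Filter Set Function Metric
open Literature.Analysis.FluidPDE

namespace Summit.NavierStokesRegularity.NavierStokesRegularity.Theorems.PoloidalLiouville.Antidynamo

/-- The toroidal field `Λ = ∇Q × id` of a `C^ω` profile is `C^ω`. [folklore] -/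
theorem contDiff_omega_cross_gradient {Q : EuclideanSpace ℝ (Fin 3) → ℝ} (hQ : ContDiff ℝ ω Q) :
    ContDiff ℝ ω fun y : EuclideanSpace ℝ (Fin 3) => cross (gradient Q y) y := by
  have hgrad : ContDiff ℝ ω (gradient Q) := by
    have h1 : ContDiff ℝ ω (fderiv ℝ Q) := hQ.fderiv_right le_rfl
    have : gradient Q = fun y => (InnerProductSpace.toDual ℝ (EuclideanSpace ℝ (Fin 3))).symm (fderiv ℝ Q y) := rfl
    rw [this]
    exact (InnerProductSpace.toDual ℝ (EuclideanSpace ℝ (Fin 3))).symm.contDiff.comp h1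
  have : (fun y : EuclideanSpace ℝ (Fin 3) => cross (gradient Q y) y) = fun y => crossCLM (gradient Q y) y := by
    funext y; rw [crossCLM_apply]
  rw [this]
  exact (crossCLM.contDiff.comp hgrad).clm_apply contDiff_id

/-- ★★ STEP S2: THE VORTICITY OF A SINGLE-DEGREE SLICE.  See the module docstring. [folklore] -/
theorem exists_analytic_coeff_curl_eq
    {v : EuclideanSpace ℝ (Fin 3) → EuclideanSpace ℝ (Fin 3)} (hv : ContDiff ℝ ω v) (hdiv : VectorCalculus.IsDivFree v)
    {φ : EuclideanSpace ℝ (Fin 3) → ℝ} {g : ℝ → ℝ} {Q : EuclideanSpace ℝ (Fin 3) → ℝ} (hQ : ContDiff ℝ ω Q) {l : ℕ}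
    (hQhom : ∀ r : ℝ, 0 < r → ∀ y : EuclideanSpace ℝ (Fin 3), Q (r • y) = r ^ l * Q y)
    (hQnc : ∀ θ : EuclideanSpace ℝ (Fin 3), ‖θ‖ = 1 → ∀ ε : ℝ, 0 < ε →
      ∃ θ' : EuclideanSpace ℝ (Fin 3), ‖θ'‖ = 1 ∧ ‖θ' - θ‖ < ε ∧ Q θ' ≠ Q θ)
    (hΛd : ∀ W : Set (EuclideanSpace ℝ (Fin 3)), IsOpen W → W.Nonempty → ∃ y ∈ W, cross (gradient Q y) y ≠ 0)
    (hΛray : ∀ y : EuclideanSpace ℝ (Fin 3), cross (gradient Q y) y ≠ 0 → ∀ r : ℝ, 0 < r →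
      cross (gradient Q (r • y)) (r • y) ≠ 0)
    (hrep : ∀ x, v x = gradient φ x + (g ‖x‖ * Q x) • x) :
    ∃ ĝ : ℝ → ℝ, ContDiffOn ℝ ω ĝ (Ioi 0) ∧
      ∀ z : EuclideanSpace ℝ (Fin 3), z ≠ 0 → curl v z = ĝ ‖z‖ • cross (gradient Q z) z := by
  have hv1 : ContDiff ℝ 1 v := hv.of_le le_top
  have hvinf : ContDiff ℝ ∞ v := hv.of_le le_top
  have hQ1 : ContDiff ℝ 1 Q := hQ.of_le le_top
  have hQinf : ContDiff ℝ ∞ Q := hQ.of_le le_top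
  set D : Set (EuclideanSpace ℝ (Fin 3)) := {z | DifferentiableAt ℝ φ z} with hD
  set U : Set (EuclideanSpace ℝ (Fin 3)) := interior D with hUdef
  have hUo : IsOpen U := isOpen_interior
  have hφU : ∀ z ∈ U, DifferentiableAt ℝ φ z := fun z hz => interior_subset (s := D) hz
  have hrepU : ∀ z ∈ U, gradient φ z = v z - (g ‖z‖ * Q z) • z := fun z _ => by
    rw [hrep z, add_sub_cancel_right]
  by_cases hUne : U.Nonempty
  swap
  · -- CASE `interior D = ∅`: the slice is radial everywhere and divergence free, hence zero
    have hpar : ∀ z, z ∉ D → cross (v z) z = 0 := by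
      intro z hz
      rw [hrep z, gradient_eq_zero_of_not_differentiableAt hz, zero_add]
      exact cross_smul_self_left _ z
    have hcont : Continuous fun z => cross (v z) z := by
      have : Continuous fun z => crossCLM (v z) z := (crossCLM.continuous.comp hv.continuous).clm_apply continuous_id
      simpa only [crossCLM_apply] using this
    have hcl : closure Dᶜ ⊆ {z | cross (v z) z = 0} :=
      closure_minimal (fun z hz => hpar z hz) (isClosed_eq hcont continuous_const)
    have hall : closure Dᶜ = univ := by
      rw [closure_compl, ← hUdef, Set.not_nonempty_iff_eq_empty.1 hUne, compl_empty]
    have hrad : ∀ z, cross (v z) z = 0 := fun z => hcl (by rw [hall]; exact mem_univ z)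
    have hzero := eq_zero_of_cross_self_eq_zero_of_isDivFree hv1 hrad hdiv
    refine ⟨fun _ => 0, contDiffOn_const, fun z _ => ?_⟩
    have hv0 : v = fun _ => (0 : EuclideanSpace ℝ (Fin 3)) := funext hzero
    rw [hv0, curl_fun_zero, zero_smul]
  -- CASE `interior D ≠ ∅`
  obtain ⟨x₁, hx₁U, hΛx₁⟩ := hΛd U hUo hUne
  have hx₁0 : x₁ ≠ 0 := by
    intro h0; apply hΛx₁; rw [h0, ← crossCLM_apply, map_zero]
  set ρ : ℝ := ‖x₁‖ with hρ
  have hρ0 : 0 < ρ := norm_pos_iff.2 hx₁0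
  set θ₁ : EuclideanSpace ℝ (Fin 3) := ρ⁻¹ • x₁ with hθ₁
  have hθ₁1 : ‖θ₁‖ = 1 := by
    rw [hθ₁, norm_smul, Real.norm_eq_abs, abs_of_pos (inv_pos.2 hρ0), ← hρ, inv_mul_cancel₀ hρ0.ne']
  have hx₁θ : x₁ = ρ • θ₁ := by rw [hθ₁, smul_smul, mul_inv_cancel₀ hρ0.ne', one_smul]
  -- a ball inside `U`
  obtain ⟨δ₀, hδ₀, hballU⟩ := Metric.isOpen_iff.1 hUo x₁ hx₁U
  set δ : ℝ := min δ₀ ρ with hδ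
  have hδpos : 0 < δ := lt_min hδ₀ hρ0
  have hδρ : δ ≤ ρ := min_le_right _ _
  have hball : ball x₁ δ ⊆ U := (ball_subset_ball (min_le_left _ _)).trans hballU
  -- a separating nearby direction `θ₂` and the sphere curve
  obtain ⟨θ₂, hθ₂1, hθ₂near, hsepθ⟩ := hQnc θ₁ hθ₁1 (min 1 (δ / (4 * ρ))) (lt_min one_pos (by positivity))
  have hθ₂ne : θ₂ ≠ -θ₁ := by
    intro h
    have : ‖θ₂ - θ₁‖ = 2 := by
      rw [h, show -θ₁ - θ₁ = (-2 : ℝ) • θ₁ by rw [neg_smul, two_smul]; abel, norm_smul, hθ₁1]; norm_num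
    linarith [lt_of_lt_of_le hθ₂near (min_le_left _ _)]
  obtain ⟨γ, hγs, hγ1, hγ0, hγone, hγnear⟩ := exists_smooth_sphereCurve hθ₁1 hθ₂1 hθ₂ne
  -- the shell of radii
  set J : Set ℝ := Ioo (ρ - δ / 2) (ρ + δ / 2) with hJ
  have hJo : IsOpen J := isOpen_Ioo
  have hJpos : ∀ r ∈ J, 0 < r := fun r hr => by
    have := hr.1; linarith
  have hρJ : ρ ∈ J := ⟨by linarith, by linarith⟩
  have hJU : ∀ r ∈ J, ∀ τ ∈ Icc (0 : ℝ) 1, r • γ τ ∈ U := by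
    intro r hr τ hτ
    apply hball
    rw [mem_ball, dist_eq_norm, hx₁θ]
    have hsplit : r • γ τ - ρ • θ₁ = (r - ρ) • γ τ + ρ • (γ τ - θ₁) := by
      rw [sub_smul, smul_sub]; abel
    rw [hsplit]
    have h1 : ‖(r - ρ) • γ τ‖ < δ / 2 := by
      rw [norm_smul, hγ1, mul_one, Real.norm_eq_abs, abs_lt]
      exact ⟨by linarith [hr.1], by linarith [hr.2]⟩
    have h2 : ‖ρ • (γ τ - θ₁)‖ ≤ δ / 2 := by
      rw [norm_smul, Real.norm_eq_abs, abs_of_pos hρ0]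
      have hθθ : ‖θ₂ - θ₁‖ < δ / (4 * ρ) := lt_of_lt_of_le hθ₂near (min_le_right _ _)
      have := hγnear τ hτ
      calc ρ * ‖γ τ - θ₁‖ ≤ ρ * (2 * ‖θ₂ - θ₁‖) := by gcongr
        _ ≤ ρ * (2 * (δ / (4 * ρ))) := by gcongr
        _ = δ / 2 := by field_simp; ring
    calc ‖(r - ρ) • γ τ + ρ • (γ τ - θ₁)‖ ≤ ‖(r - ρ) • γ τ‖ + ‖ρ • (γ τ - θ₁)‖ := norm_add_le _ _
      _ < δ / 2 + δ / 2 := add_lt_add_of_lt_of_le h1 h2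
      _ = δ := by ring
  have hsep : ∀ r ∈ J, Q (r • γ 1) ≠ Q (r • γ 0) := by
    intro r hr
    rw [hγone, hγ0, hQhom r (hJpos r hr), hQhom r (hJpos r hr)]
    intro h
    exact hsepθ (mul_left_cancel₀ (pow_ne_zero l (hJpos r hr).ne') h)
  -- (i) the coefficient is smooth on `J`
  obtain ⟨ĝ₁, hĝ₁, hgĝ₁⟩ := exists_contDiffOn_coeff_eq hvinf hQinf hφU hrepU hγs hγ1 hJo hJpos hJU hsep
  -- (ii) the vorticity form on the chunk `O = U ∩ {‖z‖ ∈ J} ∖ {0}`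
  have hform : ∀ y ∈ (U ∩ (fun z => ‖z‖) ⁻¹' J) ∩ {z | z ≠ 0}, curl v y = ĝ₁ ‖y‖ • cross (gradient Q y) y :=
    fun y hy => curl_eq_smul_cross_gradient_of_coeff hv1 hQ1 hUo hφU hrepU hJo
      (hĝ₁.of_le (by exact_mod_cast le_top)) hgĝ₁ hy.1.1 hy.1.2 hy.2
  -- (iii) analytic continuation
  set O : Set (EuclideanSpace ℝ (Fin 3)) := (U ∩ (fun z => ‖z‖) ⁻¹' J) ∩ {z | z ≠ 0} with hO
  have hOo : IsOpen O := (hUo.inter (continuous_norm.isOpen_preimage _ hJo)).inter isOpen_ne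
  have hOne : O.Nonempty := ⟨x₁, ⟨hx₁U, by rw [mem_preimage]; exact hρJ⟩, hx₁0⟩
  have hO0 : ∀ y ∈ O, y ≠ 0 := fun y hy => hy.2
  have hray : ∀ y ∈ O, ‖y‖ • θ₁ ∈ O := by
    intro y hy
    have hyJ : ‖y‖ ∈ J := hy.1.2
    have hn : ‖‖y‖ • θ₁‖ = ‖y‖ := by rw [norm_smul, norm_norm, hθ₁1, mul_one]
    refine ⟨⟨?_, ?_⟩, ?_⟩
    · have := hJU ‖y‖ hyJ 0 ⟨le_rfl, zero_le_one⟩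
      rwa [hγ0] at this
    · rw [mem_preimage, hn]; exact hyJ
    · show ‖y‖ • θ₁ ≠ 0
      rw [← norm_ne_zero_iff, hn]; exact norm_ne_zero_iff.2 hy.2
  have hΛθ : ∀ r : ℝ, 0 < r → cross (gradient Q (r • θ₁)) (r • θ₁) ≠ 0 := by
    intro r hr
    have : r • θ₁ = (r * ρ⁻¹) • x₁ := by rw [hθ₁, smul_smul]
    rw [this]
    exact hΛray x₁ hΛx₁ _ (mul_pos hr (inv_pos.2 hρ0))
  obtain ⟨hga, hcurl⟩ := curl_eq_smul_of_eqOn_chunk hv (contDiff_omega_cross_gradient hQ) hθ₁1 hΛθ hOo hOne hO0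
    hray hform
  exact ⟨_, hga, hcurl⟩

end Summit.NavierStokesRegularity.NavierStokesRegularity.Theorems.PoloidalLiouville.Antidynamo

end
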